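import Summits.AtomisticToContinuum.BoseEinsteinCondensation.Theorems.BECConjugateDominationPositiveMinimiserHeatSmooth
import HarnessLib

/-!
# Crux `HardCoreExtension`, line `third-law-current-floor` — S6r-A `stub_duhamelSmoothing`:
# the Duhamel operator maps bounded measurable data to `C¹`

For a BOUNDED MEASURABLE real `f` on `(ℝ³)^N` (no continuity) and `T ≥ 0`, the time-integrated
free flow `duhamel T f = (X ↦ ∫₀ᵀ (P_s f)(X) ds)` of `…PositiveMinimiserDefs` is `C¹`.
This is the tree's `contDiff_one_duhamel` (`…PositiveMinimiserHeatSmooth`, continuous data) with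
continuity weakened to measurability; every step is run through the Gaussian-kernel form
`P_t f (X) = ∫ gaussKer t (Y - X) f(Y) dY` instead of the Wiener-integral form:

* `hasFDerivAt_heatOp_of_measurable` — `D(P_t f)(X) = heatGrad t f X` for `t > 0`
  (differentiation of the kernel under the integral, dominated through `gaussKer_sub_le`);
* `continuous_heatGrad_of_measurable` — `X ↦ heatGrad t f X` is continuous for `t > 0`
  (same domination, the integrand `Y ↦ ⋯ f Y` being continuous in the base point for FIXED `Y`);
* `stronglyMeasurable_heatOpR`, `stronglyMeasurable_heatGrad_time` — measurability in the time
  variable from the JOINT measurability of `(s, ω) ↦ √2 b_{s⁺}(ω)` and Fubini measurability of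
  Bochner integrals;
* `hasFDerivAt_duhamel_of_measurable`, `continuous_duhamelGrad_of_measurable` and the stub.

All [folklore] (Gaussian semigroup smoothing).
-/

noncomputable section

namespace Summit.AtomisticToContinuum.BoseEinsteinCondensation.Cruxes.HardCoreExtension.ThirdLawCurrentFloor

open MeasureTheory Filter Set Metric intervalIntegral
open scoped ENNReal NNReal Topology Interval
open Literature.MathematicalPhysics.QuantumManyBody.BoseGas
open Summit.AtomisticToContinuum.BoseEinsteinCondensation.Theorems.PositiveMinimiser

namespace DuhamelSmoothing

variable {N : ℕ}

/-! ### Kernel forms for measurable data -/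

/-- **Density form of the heat operator for measurable data**:
`P_t f (X) = ∫ gaussKer t (Y - X) • f Y dY` (`t > 0`). [folklore] -/
theorem heatOp_eq_integral_gaussKer_sub_smul_of_measurable {t : ℝ≥0} (ht : t ≠ 0)
    {f : Config N → ℝ} (hf : Measurable f) (X : Config N) :
    heatOp t f X = ∫ Y, gaussKer t (Y - X) • f Y := by
  have h1 : heatOp t f X = ∫ Z, gaussKer t Z • f (X + Z) := by
    rw [heatOp]
    exact integral_displacement_eq_integral_gaussKer_smul ht
      (hf.comp (measurable_const.add measurable_id)).aestronglyMeasurable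
  rw [h1, ← integral_add_left_eq_self (fun Y => gaussKer t (Y - X) • f Y) X]
  refine integral_congr_ae (Eventually.of_forall fun Z => ?_)
  simp only [add_sub_cancel_left]

/-- The displacement integrand of the Gaussian gradient is a.e. strongly measurable for
measurable data. [folklore] -/
theorem aestronglyMeasurable_smulRight_comp_of_measurable {f : Config N → ℝ} (hf : Measurable f)
    (X : Config N) :
    AEStronglyMeasurable (fun Z : Config N => (cfgInner (N := N) Z).smulRight (f (X + Z))) volume :=
  continuous_smulRight_pair.comp_aestronglyMeasurable
    (continuous_cfgInner.aestronglyMeasurable.prodMk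
      (hf.comp (measurable_const.add measurable_id)).aestronglyMeasurable)

/-- **Density form of the Gaussian gradient for measurable data**, centred:
`heatGrad t f X = ∫ (((2t)⁻¹ gaussKer t Z) • cfgInner Z).smulRight (f (X + Z)) dZ` (`t > 0`).
[folklore] -/
theorem heatGrad_eq_integral_of_measurable {t : ℝ≥0} (ht : t ≠ 0) {f : Config N → ℝ}
    (hf : Measurable f) (X : Config N) :
    heatGrad t f X =
      ∫ Z : Config N, (((2 * (t : ℝ))⁻¹ * gaussKer t Z) • cfgInner (N := N) Z).smulRight
        (f (X + Z)) := by
  rw [heatGrad, integral_displacement_eq_integral_gaussKer_smul ht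
    (aestronglyMeasurable_smulRight_comp_of_measurable hf X), ← MeasureTheory.integral_smul]
  refine integral_congr_ae (Eventually.of_forall fun Z => ?_)
  ext h
  simp only [FunLike.coe_smul, Pi.smul_apply, ContinuousLinearMap.smulRight_apply, smul_eq_mul]
  ring

/-- **Density form of the Gaussian gradient for measurable data**:
`heatGrad t f X = ∫ (((2t)⁻¹ gaussKer t (Y - X)) • cfgInner (Y - X)).smulRight (f Y) dY`
(`t > 0`; translation invariance of Lebesgue measure). [folklore] -/
theorem heatGrad_eq_integral_sub_of_measurable {t : ℝ≥0} (ht : t ≠ 0) {f : Config N → ℝ}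
    (hf : Measurable f) (X : Config N) :
    heatGrad t f X =
      ∫ Y : Config N, (((2 * (t : ℝ))⁻¹ * gaussKer t (Y - X)) • cfgInner (N := N) (Y - X)).smulRight
        (f Y) := by
  rw [heatGrad_eq_integral_of_measurable ht hf X,
    ← integral_add_left_eq_self (μ := (volume : Measure (Config N)))
      (fun Y : Config N => (((2 * (t : ℝ))⁻¹ * gaussKer t (Y - X)) •
        cfgInner (N := N) (Y - X)).smulRight (f Y)) X]
  refine integral_congr_ae (Eventually.of_forall fun Z => ?_)
  simp only [add_sub_cancel_left]

/-! ### The kernel-form integrand of `D(P_t f)`: derivative, measurability, domination -/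

/-- The kernel-form integrand `X' ↦ gaussKer t (Y - X') • f Y` of `P_t f` has derivative
`(((2t)⁻¹ gaussKer t (Y - X')) • cfgInner (Y - X')).smulRight (f Y)` (`t > 0`). [folklore] -/
theorem hasFDerivAt_gradIntegrand {t : ℝ≥0} (ht : t ≠ 0) (f : Config N → ℝ) (Y X' : Config N) :
    HasFDerivAt (fun X'' : Config N => gaussKer t (Y - X'') • f Y)
      ((((2 * (t : ℝ))⁻¹ * gaussKer t (Y - X')) • cfgInner (N := N) (Y - X')).smulRight (f Y))
        X' := by
  have h1 : HasFDerivAt (fun X'' : Config N => Y - X'') (-(ContinuousLinearMap.id ℝ (Config N)))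
      X' := (hasFDerivAt_id X').const_sub Y
  have h2 : HasFDerivAt (fun X'' : Config N => gaussKer t (Y - X''))
      ((-(((2 * (t : ℝ))⁻¹ * gaussKer t (Y - X')) • cfgInner (Y - X'))).comp
        (-(ContinuousLinearMap.id ℝ (Config N)))) X' :=
    (hasFDerivAt_gaussKer ht (Y - X')).comp X' h1
  have h3 : HasFDerivAt (fun X'' : Config N => gaussKer t (Y - X'') • f Y)
      (((-(((2 * (t : ℝ))⁻¹ * gaussKer t (Y - X')) • cfgInner (Y - X'))).comp
        (-(ContinuousLinearMap.id ℝ (Config N)))).smulRight (f Y)) X' :=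
    h2.smul_const (f Y)
  refine h3.congr_fderiv ?_
  congr 1
  ext h
  simp

/-- The kernel-form integrand of `D(P_t f)(X')` is a.e. strongly measurable in `Y` for
measurable data. [folklore] -/
theorem aestronglyMeasurable_gradIntegrand (t : ℝ≥0) {f : Config N → ℝ} (hf : Measurable f)
    (X' : Config N) :
    AEStronglyMeasurable (fun Y : Config N =>
      (((2 * (t : ℝ))⁻¹ * gaussKer t (Y - X')) • cfgInner (N := N) (Y - X')).smulRight (f Y))
      volume := by
  refine continuous_smulRight_pair.comp_aestronglyMeasurable
    (AEStronglyMeasurable.prodMk ?_ hf.aestronglyMeasurable)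
  exact ((continuous_const.mul ((continuous_gaussKer t).comp
    (continuous_id.sub continuous_const))).smul
    (continuous_cfgInner.comp (continuous_id.sub continuous_const))).aestronglyMeasurable

/-- **Domination near the base point**: for `‖X' - X‖ ≤ 1`,
`‖(((2t)⁻¹ gaussKer t (Y - X')) • cfgInner (Y - X')).smulRight (f Y)‖ ≤
(2t)⁻¹ M K_t · gaussKer (2t) (Y - X) · (N + ∑ᵢ ‖(Y - X) i‖)` with the shift constant
`K_t = (√2 e^{1/4t})^{3N}` of `gaussKer_sub_le`. [folklore] -/
theorem norm_gradIntegrand_le (t : ℝ≥0) {f : Config N → ℝ} {M : ℝ} (hM : ∀ Y, ‖f Y‖ ≤ M)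
    {X X' : Config N} (hw : ‖X' - X‖ ≤ 1) (Y : Config N) :
    ‖(((2 * (t : ℝ))⁻¹ * gaussKer t (Y - X')) • cfgInner (N := N) (Y - X')).smulRight (f Y)‖ ≤
      (2 * (t : ℝ))⁻¹ * M *
          (∏ _i : Fin N, ∏ _k : Fin 3, (Real.sqrt 2 * Real.exp (1 ^ 2 / (4 * t)))) *
        (gaussKer (2 * t) (Y - X) * ((N : ℝ) + ∑ i, ‖(Y - X) i‖)) := by
  have hM0 : 0 ≤ M := (norm_nonneg _).trans (hM 0)
  set K : ℝ := ∏ _i : Fin N, ∏ _k : Fin 3, (Real.sqrt 2 * Real.exp (1 ^ 2 / (4 * t))) with hK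
  have hK0 : 0 ≤ K := Finset.prod_nonneg fun _ _ => Finset.prod_nonneg fun _ _ => by positivity
  have hcmp : gaussKer t (Y - X') ≤ K * gaussKer (2 * t) (Y - X) := by
    have h := gaussKer_sub_le t (Y - X) (X' - X) hw
    rwa [sub_sub_sub_cancel_right] at h
  have hpoly : ∑ i, ‖(Y - X') i‖ ≤ (N : ℝ) + ∑ i, ‖(Y - X) i‖ := by
    calc ∑ i, ‖(Y - X') i‖ ≤ ∑ i, (‖(Y - X) i‖ + 1) := by
          refine Finset.sum_le_sum fun i _ => ?_
          have e : (Y - X') i = (Y - X) i - (X' - X) i := by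
            simp only [Pi.sub_apply]; abel
          rw [e]
          exact (norm_sub_le _ _).trans (add_le_add le_rfl ((norm_le_pi_norm _ i).trans hw))
      _ = (N : ℝ) + ∑ i, ‖(Y - X) i‖ := by
          rw [Finset.sum_add_distrib]; simp [add_comm]
  calc ‖(((2 * (t : ℝ))⁻¹ * gaussKer t (Y - X')) • cfgInner (N := N) (Y - X')).smulRight (f Y)‖
        = ‖((2 * (t : ℝ))⁻¹ * gaussKer t (Y - X')) • cfgInner (Y - X')‖ * ‖f Y‖ := by
        rw [ContinuousLinearMap.norm_smulRight_apply]
    _ ≤ ((2 * (t : ℝ))⁻¹ * gaussKer t (Y - X') * ∑ i, ‖(Y - X') i‖) * M := by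
        refine mul_le_mul ?_ (hM Y) (norm_nonneg _) (mul_nonneg (mul_nonneg (by positivity)
          (gaussKer_nonneg _ _)) (Finset.sum_nonneg fun _ _ => norm_nonneg _))
        have := norm_fderiv_gaussKer_le t (Y - X')
        rwa [norm_neg] at this
    _ ≤ ((2 * (t : ℝ))⁻¹ * (K * gaussKer (2 * t) (Y - X)) * ((N : ℝ) + ∑ i, ‖(Y - X) i‖)) * M := by
        refine mul_le_mul_of_nonneg_right ?_ hM0
        exact mul_le_mul (mul_le_mul_of_nonneg_left hcmp (by positivity)) hpoly
          (Finset.sum_nonneg fun _ _ => norm_nonneg _)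
          (mul_nonneg (by positivity) (mul_nonneg hK0 (gaussKer_nonneg _ _)))
    _ = (2 * (t : ℝ))⁻¹ * M * K * (gaussKer (2 * t) (Y - X) * ((N : ℝ) + ∑ i, ‖(Y - X) i‖)) := by
        ring

/-- The dominating function of `norm_gradIntegrand_le` is Lebesgue integrable (`t > 0`).
[folklore] -/
theorem integrable_gradBound {t : ℝ≥0} (ht : t ≠ 0) (M : ℝ) (X : Config N) :
    Integrable (fun Y : Config N => (2 * (t : ℝ))⁻¹ * M *
          (∏ _i : Fin N, ∏ _k : Fin 3, (Real.sqrt 2 * Real.exp (1 ^ 2 / (4 * t)))) *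
        (gaussKer (2 * t) (Y - X) * ((N : ℝ) + ∑ i, ‖(Y - X) i‖))) volume := by
  have h2t : (2 : ℝ≥0) * t ≠ 0 := mul_ne_zero two_ne_zero ht
  exact ((integrable_gaussKer_mul_poly (N := N) h2t).comp_sub_right X).const_mul _

/-! ### One derivative of `P_t f` for bounded measurable data -/

/-- **`P_t f` is differentiable with derivative the Gaussian gradient** for `t > 0` and `f`
bounded MEASURABLE: differentiation of the Gaussian kernel under the integral sign, dominated via
the shift comparison `gaussKer_sub_le`. [folklore] -/
theorem hasFDerivAt_heatOp_of_measurable {t : ℝ≥0} (ht : t ≠ 0) {f : Config N → ℝ}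
    (hf : Measurable f) {M : ℝ} (hM : ∀ Y, ‖f Y‖ ≤ M) (X : Config N) :
    HasFDerivAt (heatOp t f) (heatGrad t f X) X := by
  set F : Config N → Config N → ℝ := fun X' Y => gaussKer t (Y - X') • f Y with hF
  set F' : Config N → Config N → Config N →L[ℝ] ℝ := fun X' Y =>
    (((2 * (t : ℝ))⁻¹ * gaussKer t (Y - X')) • cfgInner (Y - X')).smulRight (f Y) with hF'
  have hfun : heatOp t f = fun X' => ∫ Y, F X' Y := by
    funext X'; exact heatOp_eq_integral_gaussKer_sub_smul_of_measurable ht hf X'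
  have hFmeas : ∀ X', AEStronglyMeasurable (F X') volume := fun X' =>
    ((continuous_gaussKer t).comp (continuous_id.sub continuous_const)).aestronglyMeasurable.smul
      hf.aestronglyMeasurable
  have hFint : Integrable (F X) volume := by
    refine Integrable.mono' (((integrable_gaussKer ht).comp_sub_right X).mul_const M) (hFmeas X)
      (Eventually.of_forall fun Y => ?_)
    simp only [hF, norm_smul, Real.norm_of_nonneg (gaussKer_nonneg _ _)]
    exact mul_le_mul_of_nonneg_left (hM Y) (gaussKer_nonneg _ _)
  have hbd : ∀ᵐ Y ∂volume, ∀ X' ∈ ball X 1, ‖F' X' Y‖ ≤ (2 * (t : ℝ))⁻¹ * M *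
          (∏ _i : Fin N, ∏ _k : Fin 3, (Real.sqrt 2 * Real.exp (1 ^ 2 / (4 * t)))) *
        (gaussKer (2 * t) (Y - X) * ((N : ℝ) + ∑ i, ‖(Y - X) i‖)) :=
    Eventually.of_forall fun Y X' hX' => norm_gradIntegrand_le t hM (mem_ball_iff_norm.1 hX').le Y
  have hmain := hasFDerivAt_integral_of_dominated_of_fderiv_le (F := F) (F' := F') (x₀ := X)
    (ball_mem_nhds X one_pos) (Eventually.of_forall hFmeas) hFint
    (aestronglyMeasurable_gradIntegrand t hf X) hbd (integrable_gradBound ht M X)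
    (Eventually.of_forall fun Y X' _ => hasFDerivAt_gradIntegrand ht f Y X')
  have key : (∫ Y, F' X Y) = heatGrad t f X := (heatGrad_eq_integral_sub_of_measurable ht hf X).symm
  rw [hfun, ← key]
  exact hmain

/-- **The Gaussian gradient of bounded measurable data is continuous in the base point**
(`t > 0`): dominated convergence in the kernel form, the integrand being continuous in the base
point for every FIXED `Y`. [folklore] -/
theorem continuous_heatGrad_of_measurable {t : ℝ≥0} (ht : t ≠ 0) {f : Config N → ℝ}
    (hf : Measurable f) {M : ℝ} (hM : ∀ Y, ‖f Y‖ ≤ M) :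
    Continuous fun X : Config N => heatGrad t f X := by
  set F' : Config N → Config N → Config N →L[ℝ] ℝ := fun X' Y =>
    (((2 * (t : ℝ))⁻¹ * gaussKer t (Y - X')) • cfgInner (Y - X')).smulRight (f Y) with hF'
  have hfun : (fun X : Config N => heatGrad t f X) = fun X' => ∫ Y, F' X' Y := by
    funext X'; exact heatGrad_eq_integral_sub_of_measurable ht hf X'
  rw [hfun]
  refine continuous_iff_continuousAt.2 fun X => ?_
  refine continuousAt_of_dominated
    (Eventually.of_forall fun X' => aestronglyMeasurable_gradIntegrand t hf X') ?_
    (integrable_gradBound ht M X) (Eventually.of_forall fun Y => ?_)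
  · filter_upwards [ball_mem_nhds X one_pos] with X' hX'
    exact Eventually.of_forall fun Y => norm_gradIntegrand_le t hM (mem_ball_iff_norm.1 hX').le Y
  · refine (continuous_smulRight_pair.comp (Continuous.prodMk ?_ continuous_const)).continuousAt
    exact (continuous_const.mul ((continuous_gaussKer t).comp
      (continuous_const.sub continuous_id))).smul
      (continuous_cfgInner.comp (continuous_const.sub continuous_id))

/-! ### Measurability in the time variable -/

/-- `(s, ω) ↦ √2 b_{s⁺}(ω)` is jointly measurable in (real time, sample). [folklore] -/
theorem measurable_displacement_toNNReal :
    Measurable fun p : ℝ × PathSpace N => displacement p.1.toNNReal p.2 :=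
  measurable_displacement_uncurry.comp
    ((measurable_real_toNNReal.comp measurable_fst).prodMk measurable_snd)

/-- **`s ↦ heatOpR s f X` is strongly measurable** for measurable real `f` (Fubini measurability
of the Bochner integral of the jointly measurable `(s, ω) ↦ f (X + √2 b_{s⁺}(ω))`). [folklore] -/
theorem stronglyMeasurable_heatOpR {f : Config N → ℝ} (hf : Measurable f) (X : Config N) :
    StronglyMeasurable fun s : ℝ => heatOpR s f X := by
  have h : StronglyMeasurable fun p : ℝ × PathSpace N => f (X + displacement p.1.toNNReal p.2) :=
    (hf.comp (measurable_const.add measurable_displacement_toNNReal)).stronglyMeasurable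
  exact h.integral_prod_right' (ν := wienerPaths N)

/-- **`s ↦ heatGrad s⁺ f X` is strongly measurable** for measurable real `f`. [folklore] -/
theorem stronglyMeasurable_heatGrad_time {f : Config N → ℝ} (hf : Measurable f) (X : Config N) :
    StronglyMeasurable fun s : ℝ => heatGrad s.toNNReal f X := by
  have h1 : StronglyMeasurable fun p : ℝ × PathSpace N =>
      (cfgInner (N := N) (displacement p.1.toNNReal p.2)).smulRight
        (f (X + displacement p.1.toNNReal p.2)) :=
    continuous_smulRight_pair.comp_stronglyMeasurable
      ((continuous_cfgInner.comp_stronglyMeasurable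
        measurable_displacement_toNNReal.stronglyMeasurable).prodMk
        (hf.comp (measurable_const.add measurable_displacement_toNNReal)).stronglyMeasurable)
  have h2 := h1.integral_prod_right' (ν := wienerPaths N)
  have h3 : StronglyMeasurable fun s : ℝ => ((2 * ((s.toNNReal : ℝ≥0) : ℝ))⁻¹ : ℝ) :=
    (measurable_const.mul measurable_real_toNNReal.coe_nnreal_real).inv.stronglyMeasurable
  exact h3.smul h2

/-- `s ↦ heatOpR s f X` is interval integrable for bounded measurable real `f`. [folklore] -/
theorem intervalIntegrable_heatOpR {f : Config N → ℝ} (hf : Measurable f) {M : ℝ}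
    (hM : ∀ Y, ‖f Y‖ ≤ M) (X : Config N) (a b : ℝ) :
    IntervalIntegrable (fun s : ℝ => heatOpR s f X) volume a b :=
  (intervalIntegrable_const (c := M)).mono_fun'
    (stronglyMeasurable_heatOpR hf X).aestronglyMeasurable
    (Eventually.of_forall fun s => norm_heatOp_le hM s.toNNReal X)

/-! ### Derivative of the Duhamel term for bounded measurable data -/

/-- **Derivative of the Duhamel term for bounded measurable data**: for `T ≥ 0`,
`D(duhamel T f)(X) = ∫₀ᵀ heatGrad s f X ds`. [folklore] -/
theorem hasFDerivAt_duhamel_of_measurable {f : Config N → ℝ} (hf : Measurable f) {M : ℝ}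
    (hM : ∀ Y, ‖f Y‖ ≤ M) {T : ℝ} (hT : 0 ≤ T) (X : Config N) :
    HasFDerivAt (duhamel T f) (∫ s in (0 : ℝ)..T, heatGrad s.toNNReal f X) X := by
  set C : ℝ := N * M * (Real.sqrt 2 * (3 * N : ℕ)) with hC
  have h := hasFDerivAt_integral_of_dominated_of_fderiv_le'' (μ := volume)
    (F := fun X' s => heatOpR s f X') (F' := fun X' s => heatGrad s.toNNReal f X') (x₀ := X)
    (a := 0) (b := T) (bound := fun s => C * s ^ (-(1 / 2 : ℝ))) (ball_mem_nhds X one_pos)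
    (Eventually.of_forall fun X' => (stronglyMeasurable_heatOpR hf X').aestronglyMeasurable)
    (intervalIntegrable_heatOpR hf hM X 0 T)
    (stronglyMeasurable_heatGrad_time hf X).aestronglyMeasurable ?_
    (intervalIntegrable_const_mul_rpow C 0 T) ?_
  · exact h
  · rw [uIoc_of_le hT, ae_restrict_iff' measurableSet_Ioc]
    refine Eventually.of_forall fun s hs X' _ => ?_
    exact norm_heatGrad_le_rpow hM hs.1 X'
  · rw [uIoc_of_le hT, ae_restrict_iff' measurableSet_Ioc]
    refine Eventually.of_forall fun s hs X' _ => ?_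
    have hs' : s.toNNReal ≠ 0 := by
      rw [ne_eq, Real.toNNReal_eq_zero, not_le]; exact hs.1
    exact hasFDerivAt_heatOp_of_measurable hs' hf hM X'

/-- **The derivative of the Duhamel term is continuous in the base point** (bounded measurable
data, `T ≥ 0`). [folklore] -/
theorem continuous_duhamelGrad_of_measurable {f : Config N → ℝ} (hf : Measurable f) {M : ℝ}
    (hM : ∀ Y, ‖f Y‖ ≤ M) {T : ℝ} (hT : 0 ≤ T) :
    Continuous fun X : Config N => ∫ s in (0 : ℝ)..T, heatGrad s.toNNReal f X := by
  set C : ℝ := N * M * (Real.sqrt 2 * (3 * N : ℕ)) with hC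
  refine intervalIntegral.continuous_of_dominated_interval
    (bound := fun s => C * s ^ (-(1 / 2 : ℝ)))
    (fun X => (stronglyMeasurable_heatGrad_time hf X).aestronglyMeasurable) (fun X => ?_)
    (intervalIntegrable_const_mul_rpow C 0 T) ?_
  · refine Eventually.of_forall fun s hs => ?_
    rw [uIoc_of_le hT] at hs
    exact norm_heatGrad_le_rpow hM hs.1 X
  · refine Eventually.of_forall fun s hs => ?_
    rw [uIoc_of_le hT] at hs
    have hs' : s.toNNReal ≠ 0 := by
      rw [ne_eq, Real.toNNReal_eq_zero, not_le]; exact hs.1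
    exact continuous_heatGrad_of_measurable hs' hf hM

end DuhamelSmoothing

/-- **S6r-A `stub_duhamelSmoothing`** (Gaussian smoothing of BOUNDED MEASURABLE data by the
Duhamel operator). For a bounded measurable real `f` on `(ℝ³)^N` and `T ≥ 0`,
`duhamel T f = (X ↦ ∫₀ᵀ (P_s f)(X) ds)` is `C¹`, with
`fderiv (duhamel T f) X = ∫₀ᵀ heatGrad s f X ds`: for `s > 0`, `P_s f` is differentiable with
derivative the Gaussian gradient, bounded by `3√2 N² ‖f‖_∞ / √s` (integrable at `s = 0`) and
continuous in `X`; differentiate the `s`-integral under the integral sign. The tree's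
`contDiff_one_duhamel` with continuity of the data weakened to measurability. [folklore] -/
theorem stub_duhamelSmoothing :
    ∀ {N : ℕ} (f : Config N → ℝ), Measurable f → (∃ M : ℝ, ∀ Y, ‖f Y‖ ≤ M) →
      ∀ T : ℝ, 0 ≤ T → ContDiff ℝ 1 (duhamel T f) := by
  intro N f hf hb T hT
  obtain ⟨M, hM⟩ := hb
  have hd : ∀ X, HasFDerivAt (duhamel T f) (∫ s in (0 : ℝ)..T, heatGrad s.toNNReal f X) X :=
    fun X => DuhamelSmoothing.hasFDerivAt_duhamel_of_measurable hf hM hT X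
  have hfd : fderiv ℝ (duhamel T f) = fun X => ∫ s in (0 : ℝ)..T, heatGrad s.toNNReal f X :=
    funext fun X => (hd X).fderiv
  rw [contDiff_one_iff_fderiv, hfd]
  exact ⟨fun X => (hd X).differentiableAt,
    DuhamelSmoothing.continuous_duhamelGrad_of_measurable hf hM hT⟩

end Summit.AtomisticToContinuum.BoseEinsteinCondensation.Cruxes.HardCoreExtension.ThirdLawCurrentFloor

end
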